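import Summits.ResolutionOfSingularities.ResolutionOfSingularities.Theses.FrobeniusClosing
import Summits.ResolutionOfSingularities.ResolutionOfSingularities.Theorems.KedlayaReduction.Negative.ConclusionFalseWithoutHypotheses
import Literature.AlgebraicGeometry.Resolution.ResolutionLU
import Literature.AlgebraicGeometry.Resolution.GeneralLU
import Literature.AlgebraicGeometry.Resolution.AffineModelObstructions

/-!
# Negative-lane lemmas for crux `PatchingRelPerfect` (stmt-ResolutionOfSingularities-16161):
# no slack, and the load-bearing hypotheses of its antecedent and consequent

The crux (one term in seven routes; here `FrobeniusClosing.PatchingRelPerfect`) is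
`∀ p prime, LUrelPerfect_p → ResPerfect_p`: relative Zariski local uniformization for every finitely
generated `K/k` over every PERFECT field `k` of characteristic `p` implies resolution of every
reduced separated scheme of finite type over every perfect field of characteristic `p`. Findings of
the standing disprover (`Cruxes/PatchingRelPerfect/Disproof.lean`, cycles 1–2), PROVED, with the
antecedent `LUrelPerfect_p` and consequent `ResPerfect_p` written out verbatim (no new `def`):

* `lurelPerfect_of_resPerfect` — **NO SLACK**: the converse `ResPerfect_p → LUrelPerfect_p` holds
  fibrewise (resolve `Spec (R ⊔ A₀)` over the same perfect `k`, lift `Spec O` by the valuative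
  criterion; tree `exists_affineModel_regular_of_hasResolution`), hence
  `not_patchingRelPerfect_iff : ¬ PatchingRelPerfect ↔ ∃ p prime, LUrelPerfect_p ∧ ¬ ResPerfect_p`
  and `patchingRelPerfect_iff_resPerfect_of_lurelPerfect`: a refutation must PROVE local
  uniformization over perfect fields in some characteristic AND refute resolution over a perfect
  field there; under LU the crux IS resolution over perfect fields.
* Antecedent, `(⊤ : IntermediateField k K).FG` dropped — FALSE at `𝔽_p`
  (`not_lurelPerfect_without_fg`, witness `𝔽_p^alg / 𝔽_p`): the crux with that antecedent holds
  vacuously, a TRAP (`patchingRelPerfect_without_fg_vacuous`).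
* Antecedent, `R.FG` dropped — FALSE at `𝔽_p` (`not_lurelPerfect_without_rfg`, witness
  `R = K = 𝔽_p(X)` at the trivial valuation): second trap (`patchingRelPerfect_without_rfg_vacuous`).
* Consequent, `IsReduced X` / `LocallyOfFiniteType f` dropped — FALSE at `𝔽_p` (landed for the
  sibling crux `KedlayaReduction`: `kedlayaReduction_conclusion_false_without_isReduced`,
  `…_without_locallyOfFiniteType`, witnesses `Spec 𝔽_p[ε]`, `Spec 𝔽_p[X]⁺`), so each mutated crux
  is EQUIVALENT to `∀ p prime, ¬ LUrelPerfect_p`, the failure of local uniformization over perfect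
  fields (`patchingRelPerfect_without_reduced_iff`, `patchingRelPerfect_without_finiteType_iff`):
  both hypotheses are LOAD-BEARING.
-/

set_option linter.dupNamespace false

noncomputable section

namespace Summit.ResolutionOfSingularities.ResolutionOfSingularities.Theorems.PatchingRelPerfect.Negative

open Literature.AlgebraicGeometry.Resolution
open Summit.ResolutionOfSingularities.ResolutionOfSingularities.Theses
open Summit.ResolutionOfSingularities.ResolutionOfSingularities.Theorems.KedlayaReduction.Negative
open CategoryTheory AlgebraicGeometry

/-- **The converse of the crux holds FIBREWISE** (no slack): resolution over perfect fields of
characteristic `p` (`ResPerfect_p`, hypothesis `h`) gives relative local uniformization over perfect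
fields of characteristic `p` (`LUrelPerfect_p`, the conclusion) — enlarge the prescribed `R` by an
affine model `A₀ ⊆ O` of `K` (`exists_affineModel`), resolve `Spec (R ⊔ A₀)` (a reduced affine
`k`-scheme of finite type over the SAME perfect `k`) and lift `Spec O` to the resolution by the
valuative criterion (`exists_affineModel_regular_of_hasResolution`). [folklore] -/
theorem lurelPerfect_of_resPerfect (p : ℕ)
    (h : ∀ (k : Type) [Field k] [CharP k p] [PerfectField k] (X : Scheme.{0}) (f : X ⟶ Spec (.of k)),
      IsSeparated f → LocallyOfFiniteType f → QuasiCompact f → IsReduced X → Scheme.HasResolution X) :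
    ∀ (k K : Type) [Field k] [CharP k p] [PerfectField k] [Field K] [Algebra k K],
      (⊤ : IntermediateField k K).FG →
      ∀ O : ValuationSubring K, (∀ c : k, algebraMap k K c ∈ O) → ∀ R : Subalgebra k K, R.FG →
        R.toSubring ≤ O.toSubring → ∃ (A : Subalgebra k K) (h : A.toSubring ≤ O.toSubring),
          R ≤ A ∧ A.FG ∧ IsFractionRing A K ∧ IsRegularLocalRing (Localization.AtPrime
            (Ideal.comap (Subring.inclusion h) (IsLocalRing.maximalIdeal O))) := by
  intro k K _ _ _ _ _ hKfg O hO R hRfg hRO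
  obtain ⟨A₀, hA₀O, hA₀fg, hA₀fr⟩ := exists_affineModel k K hKfg O hO
  let O' : Subalgebra k K := { O.toSubring with algebraMap_mem' := hO }
  have hR'O : (R ⊔ A₀).toSubring ≤ O.toSubring := by
    change R ⊔ A₀ ≤ O'
    exact sup_le (fun x hx => hRO hx) (fun x hx => hA₀O hx)
  have hR'fg : (R ⊔ A₀).FG := hRfg.sup hA₀fg
  have hR'fr : IsFractionRing ↥(R ⊔ A₀) K := isFractionRing_of_le le_sup_right hA₀fr
  haveI : Algebra.FiniteType k ↥(R ⊔ A₀) := (R ⊔ A₀).fg_iff_finiteType.mp hR'fg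
  have hres : Scheme.HasResolution (Spec (.of ↥(R ⊔ A₀))) := by
    let f : Spec (.of ↥(R ⊔ A₀)) ⟶ Spec (.of k) :=
      Spec.map (CommRingCat.ofHom (algebraMap k ↥(R ⊔ A₀)))
    haveI : LocallyOfFiniteType f :=
      (HasRingHomProperty.Spec_iff (P := @LocallyOfFiniteType)).mpr
        (RingHom.finiteType_algebraMap.mpr ‹_›)
    exact h k (Spec (.of ↥(R ⊔ A₀))) f inferInstance inferInstance inferInstance inferInstance
  obtain ⟨A, hA, hle, hAfg, hreg⟩ :=
    exists_affineModel_regular_of_hasResolution O (R ⊔ A₀) hR'O hR'fg hR'fr hres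
  exact ⟨A, hA, le_sup_left.trans hle, hAfg, isFractionRing_of_le hle hR'fr, hreg⟩

/-- **Why the crux resists refutation**: `¬ PatchingRelPerfect` is EXACTLY a prime `p` at which
local uniformization over perfect fields HOLDS and resolution over some perfect field FAILS.
[folklore] -/
theorem not_patchingRelPerfect_iff :
    ¬ FrobeniusClosing.PatchingRelPerfect ↔ ∃ p : ℕ, p.Prime ∧
      (∀ (k K : Type) [Field k] [CharP k p] [PerfectField k] [Field K] [Algebra k K],
      (⊤ : IntermediateField k K).FG →
      ∀ O : ValuationSubring K, (∀ c : k, algebraMap k K c ∈ O) → ∀ R : Subalgebra k K, R.FG →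
        R.toSubring ≤ O.toSubring → ∃ (A : Subalgebra k K) (h : A.toSubring ≤ O.toSubring),
          R ≤ A ∧ A.FG ∧ IsFractionRing A K ∧ IsRegularLocalRing (Localization.AtPrime
            (Ideal.comap (Subring.inclusion h) (IsLocalRing.maximalIdeal O)))) ∧
      ¬ (∀ (k : Type) [Field k] [CharP k p] [PerfectField k] (X : Scheme.{0}) (f : X ⟶ Spec (.of k)),
      IsSeparated f → LocallyOfFiniteType f → QuasiCompact f → IsReduced X → Scheme.HasResolution X) := by
  constructor
  · intro h
    by_contra h'
    exact h fun p hp hLU => by_contra fun hR => h' ⟨p, hp, hLU, hR⟩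
  · rintro ⟨p, hp, hLU, hR⟩ h
    exact hR (h p hp hLU)

/-- **Under local uniformization over perfect fields (believed in every characteristic; a theorem in
transcendence degree `≤ 3`) the crux IS resolution over perfect fields**: nothing weaker discharges
it, and the summit's perfect-field slice is `(∀ p prime, LUrelPerfect_p) ∧ PatchingRelPerfect`.
[folklore] -/
theorem patchingRelPerfect_iff_resPerfect_of_lurelPerfect
    (hLU : ∀ p : ℕ, p.Prime →
      (∀ (k K : Type) [Field k] [CharP k p] [PerfectField k] [Field K] [Algebra k K],
      (⊤ : IntermediateField k K).FG →
      ∀ O : ValuationSubring K, (∀ c : k, algebraMap k K c ∈ O) → ∀ R : Subalgebra k K, R.FG →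
        R.toSubring ≤ O.toSubring → ∃ (A : Subalgebra k K) (h : A.toSubring ≤ O.toSubring),
          R ≤ A ∧ A.FG ∧ IsFractionRing A K ∧ IsRegularLocalRing (Localization.AtPrime
            (Ideal.comap (Subring.inclusion h) (IsLocalRing.maximalIdeal O))))) :
    FrobeniusClosing.PatchingRelPerfect ↔ ∀ p : ℕ, p.Prime →
      (∀ (k : Type) [Field k] [CharP k p] [PerfectField k] (X : Scheme.{0}) (f : X ⟶ Spec (.of k)),
      IsSeparated f → LocallyOfFiniteType f → QuasiCompact f → IsReduced X → Scheme.HasResolution X) :=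
  ⟨fun h p hp => h p hp (hLU p hp), fun h p hp _ => h p hp⟩

/-- **`(⊤ : IntermediateField k K).FG` is load-bearing for the ANTECEDENT**: local uniformization
demanded for ALL extensions `K/k` (finite generation dropped) fails already over the perfect field
`𝔽_p` — `𝔽_p^alg / 𝔽_p` has no affine model (tree `not_exists_fg_isFractionRing_algebraicClosure`;
witness `O = ⊤`, `R = ⊥`). [folklore] -/
theorem not_lurelPerfect_without_fg (p : ℕ) (hp : p.Prime) :
    ¬ ∀ (k K : Type) [Field k] [CharP k p] [PerfectField k] [Field K] [Algebra k K],
      ∀ O : ValuationSubring K, (∀ c : k, algebraMap k K c ∈ O) → ∀ R : Subalgebra k K, R.FG →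
        R.toSubring ≤ O.toSubring → ∃ (A : Subalgebra k K) (h : A.toSubring ≤ O.toSubring),
          R ≤ A ∧ A.FG ∧ IsFractionRing A K ∧ IsRegularLocalRing (Localization.AtPrime
            (Ideal.comap (Subring.inclusion h) (IsLocalRing.maximalIdeal O))) := by
  haveI : Fact p.Prime := ⟨hp⟩
  intro h
  obtain ⟨A, -, -, hfg, hfr, -⟩ := h (ZMod p) (AlgebraicClosure (ZMod p)) ⊤
    (fun c => ValuationSubring.mem_top _) ⊥ Subalgebra.fg_bot (fun x _ => trivial)
  exact not_exists_fg_isFractionRing_algebraicClosure p ⟨A, hfg, hfr⟩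

/-- … so the crux with that weakened antecedent holds VACUOUSLY — a trap: it proves nothing about
resolution. [folklore] -/
theorem patchingRelPerfect_without_fg_vacuous (p : ℕ) (hp : p.Prime)
    (h : ∀ (k K : Type) [Field k] [CharP k p] [PerfectField k] [Field K] [Algebra k K],
      ∀ O : ValuationSubring K, (∀ c : k, algebraMap k K c ∈ O) → ∀ R : Subalgebra k K, R.FG →
        R.toSubring ≤ O.toSubring → ∃ (A : Subalgebra k K) (h : A.toSubring ≤ O.toSubring),
          R ≤ A ∧ A.FG ∧ IsFractionRing A K ∧ IsRegularLocalRing (Localization.AtPrime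
            (Ideal.comap (Subring.inclusion h) (IsLocalRing.maximalIdeal O)))) :
    ∀ (k : Type) [Field k] [CharP k p] [PerfectField k] (X : Scheme.{0}) (f : X ⟶ Spec (.of k)),
      IsSeparated f → LocallyOfFiniteType f → QuasiCompact f → IsReduced X → Scheme.HasResolution X :=
  absurd h (not_lurelPerfect_without_fg p hp)

/-- **`R.FG` is load-bearing for the ANTECEDENT**: local uniformization demanded for ALL
`k`-subalgebras `R ⊆ O` fails already over the perfect field `𝔽_p` (witness `K = 𝔽_p(X)`, `O = K`,
`R = K`: a finitely generated `A ⊇ K` would make `𝔽_p(X)` a finitely generated `𝔽_p`-algebra,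
contradicting Zariski's lemma). The all-fields version is the twin's tree theorem
`PatchingRel.Negative.not_lurel_without_rfg`; over perfect `k` the same witness bites. [folklore] -/
theorem not_lurelPerfect_without_rfg (p : ℕ) (hp : p.Prime) :
    ¬ ∀ (k K : Type) [Field k] [CharP k p] [PerfectField k] [Field K] [Algebra k K],
      (⊤ : IntermediateField k K).FG → ∀ O : ValuationSubring K,
        (∀ c : k, algebraMap k K c ∈ O) → ∀ R : Subalgebra k K, R.toSubring ≤ O.toSubring →
          ∃ (A : Subalgebra k K) (h : A.toSubring ≤ O.toSubring), R ≤ A ∧ A.FG ∧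
            IsFractionRing A K ∧ IsRegularLocalRing (Localization.AtPrime
              (Ideal.comap (Subring.inclusion h) (IsLocalRing.maximalIdeal O))) := by
  intro h
  haveI : Fact p.Prime := ⟨hp⟩
  obtain ⟨A, -, hle, hAfg, -, -⟩ := h (ZMod p) (FractionRing (Polynomial (ZMod p)))
    (IntermediateField.fg_top_iff.mpr
      (Algebra.EssFiniteType.comp (ZMod p) (Polynomial (ZMod p)) _))
    ⊤ (fun _ => ValuationSubring.mem_top _) ⊤ (fun _ _ => ValuationSubring.mem_top _)
  have htop : (⊤ : Subalgebra (ZMod p) (FractionRing (Polynomial (ZMod p)))).FG := by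
    rwa [← eq_top_iff.mpr hle]
  haveI : Algebra.FiniteType (ZMod p) (FractionRing (Polynomial (ZMod p))) := ⟨htop⟩
  haveI : Module.Finite (ZMod p) (FractionRing (Polynomial (ZMod p))) :=
    finite_of_finite_type_of_isJacobsonRing (ZMod p) _
  have hT : Transcendental (ZMod p)
      (algebraMap (Polynomial (ZMod p)) (FractionRing (Polynomial (ZMod p))) Polynomial.X) :=
    (transcendental_algebraMap_iff (IsFractionRing.injective (Polynomial (ZMod p)) _)).mpr
      (Polynomial.transcendental_X (ZMod p))
  exact hT (Algebra.IsAlgebraic.isAlgebraic _)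

/-- … so the crux with that weakened antecedent holds VACUOUSLY — a second trap. [folklore] -/
theorem patchingRelPerfect_without_rfg_vacuous (p : ℕ) (hp : p.Prime)
    (h : ∀ (k K : Type) [Field k] [CharP k p] [PerfectField k] [Field K] [Algebra k K],
      (⊤ : IntermediateField k K).FG → ∀ O : ValuationSubring K,
        (∀ c : k, algebraMap k K c ∈ O) → ∀ R : Subalgebra k K, R.toSubring ≤ O.toSubring →
          ∃ (A : Subalgebra k K) (h : A.toSubring ≤ O.toSubring), R ≤ A ∧ A.FG ∧
            IsFractionRing A K ∧ IsRegularLocalRing (Localization.AtPrime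
              (Ideal.comap (Subring.inclusion h) (IsLocalRing.maximalIdeal O)))) :
    ∀ (k : Type) [Field k] [CharP k p] [PerfectField k] (X : Scheme.{0}) (f : X ⟶ Spec (.of k)),
      IsSeparated f → LocallyOfFiniteType f → QuasiCompact f → IsReduced X → Scheme.HasResolution X :=
  absurd h (not_lurelPerfect_without_rfg p hp)

/-- **`IsReduced X` is load-bearing in the CONSEQUENT**: the crux with `IsReduced` dropped from its
consequent is EQUIVALENT to the failure of local uniformization over perfect fields in every prime
characteristic (believed false; a refutation of this mutation would be a PROOF of LU) — the consequent
without `IsReduced` is false at `𝔽_p` by `Spec 𝔽_p[ε]`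
(`kedlayaReduction_conclusion_false_without_isReduced`). [folklore] -/
theorem patchingRelPerfect_without_reduced_iff :
    (∀ p : ℕ, p.Prime →
      (∀ (k K : Type) [Field k] [CharP k p] [PerfectField k] [Field K] [Algebra k K],
      (⊤ : IntermediateField k K).FG →
      ∀ O : ValuationSubring K, (∀ c : k, algebraMap k K c ∈ O) → ∀ R : Subalgebra k K, R.FG →
        R.toSubring ≤ O.toSubring → ∃ (A : Subalgebra k K) (h : A.toSubring ≤ O.toSubring),
          R ≤ A ∧ A.FG ∧ IsFractionRing A K ∧ IsRegularLocalRing (Localization.AtPrime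
            (Ideal.comap (Subring.inclusion h) (IsLocalRing.maximalIdeal O)))) →
      ∀ (k : Type) [Field k] [CharP k p] [PerfectField k] (X : Scheme.{0}) (f : X ⟶ Spec (.of k)),
        IsSeparated f → LocallyOfFiniteType f → QuasiCompact f → Scheme.HasResolution X) ↔
      ∀ p : ℕ, p.Prime → ¬
        (∀ (k K : Type) [Field k] [CharP k p] [PerfectField k] [Field K] [Algebra k K],
      (⊤ : IntermediateField k K).FG →
      ∀ O : ValuationSubring K, (∀ c : k, algebraMap k K c ∈ O) → ∀ R : Subalgebra k K, R.FG →
        R.toSubring ≤ O.toSubring → ∃ (A : Subalgebra k K) (h : A.toSubring ≤ O.toSubring),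
          R ≤ A ∧ A.FG ∧ IsFractionRing A K ∧ IsRegularLocalRing (Localization.AtPrime
            (Ideal.comap (Subring.inclusion h) (IsLocalRing.maximalIdeal O)))) :=
  ⟨fun h p hp hLU => kedlayaReduction_conclusion_false_without_isReduced p hp (h p hp hLU),
    fun h p hp hLU => absurd hLU (h p hp)⟩

/-- **`LocallyOfFiniteType f` is load-bearing in the CONSEQUENT**: the crux with finite type
dropped from its consequent is again EQUIVALENT to the failure of LU over perfect fields in every
prime characteristic — the consequent without finite type is false at `𝔽_p` by `Spec 𝔽_p[X]⁺`
(`kedlayaReduction_conclusion_false_without_locallyOfFiniteType`). [folklore] -/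
theorem patchingRelPerfect_without_finiteType_iff :
    (∀ p : ℕ, p.Prime →
      (∀ (k K : Type) [Field k] [CharP k p] [PerfectField k] [Field K] [Algebra k K],
      (⊤ : IntermediateField k K).FG →
      ∀ O : ValuationSubring K, (∀ c : k, algebraMap k K c ∈ O) → ∀ R : Subalgebra k K, R.FG →
        R.toSubring ≤ O.toSubring → ∃ (A : Subalgebra k K) (h : A.toSubring ≤ O.toSubring),
          R ≤ A ∧ A.FG ∧ IsFractionRing A K ∧ IsRegularLocalRing (Localization.AtPrime
            (Ideal.comap (Subring.inclusion h) (IsLocalRing.maximalIdeal O)))) →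
      ∀ (k : Type) [Field k] [CharP k p] [PerfectField k] (X : Scheme.{0}) (f : X ⟶ Spec (.of k)),
        IsSeparated f → QuasiCompact f → IsReduced X → Scheme.HasResolution X) ↔
      ∀ p : ℕ, p.Prime → ¬
        (∀ (k K : Type) [Field k] [CharP k p] [PerfectField k] [Field K] [Algebra k K],
      (⊤ : IntermediateField k K).FG →
      ∀ O : ValuationSubring K, (∀ c : k, algebraMap k K c ∈ O) → ∀ R : Subalgebra k K, R.FG →
        R.toSubring ≤ O.toSubring → ∃ (A : Subalgebra k K) (h : A.toSubring ≤ O.toSubring),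
          R ≤ A ∧ A.FG ∧ IsFractionRing A K ∧ IsRegularLocalRing (Localization.AtPrime
            (Ideal.comap (Subring.inclusion h) (IsLocalRing.maximalIdeal O)))) :=
  ⟨fun h p hp hLU => kedlayaReduction_conclusion_false_without_locallyOfFiniteType p hp (h p hp hLU),
    fun h p hp hLU => absurd hLU (h p hp)⟩

end Summit.ResolutionOfSingularities.ResolutionOfSingularities.Theorems.PatchingRelPerfect.Negative

end
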